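import Literature.NumberTheory.EllipticCurves.TorsionCardinality
import Literature.NumberTheory.EllipticCurves.PointDivisibilityProofs
import HarnessLib

/-!
# The fibres of `[n]` and the points of order `p²` on an elliptic curve over `K̄`: `p²(p² − 1)` of them, in `p² − 1` cosets of `E[p]`

Topic `Literature/NumberTheory/EllipticCurves`, namespace `Literature.NumberTheory.EllipticCurves`.
Lane `lit-hodgefound`, seat `lit-hodgefound-p37`, row g21-#2 (FILE 1 of 2): the group-theoretic content of
Artebani–Dolgachev's proof of Prop. 5.2 — "`B̄ᵢ` cuts out on each nonsingular fibre the `Γ`-orbit of a point of order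
`9`", "the union of the eight cubics `Bᵢ` cuts out … the set of points of order `9`" — for the group `E(K̄)` of an
arbitrary elliptic curve and an arbitrary prime `p ≠ char`, on top of the tree's `#E[n] = n²`
(`WeierstrassCurve.card_torsionBy_eq_sq`, `TorsionCardinality`, Silverman AEC III.6.4 (b)) and "`[n]` is onto `E(K̄)`"
(`WeierstrassCurve.nsmul_surjective_of_isAlgClosed`, `PointDivisibilityProofs`, Silverman AEC III.4.2 (a)).  FILE 2
(`AlgebraicGeometry/PlaneCurves/HessePencilOrderNineOrbits`) reads these through the seat's dictionary
`Bᵢ(N vec P) = 0 ↔ 3P + Tᵢ = O` (`HessePencilPointsOfOrderNine`, Q2770).  Everything here is PROVED; no definition,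
no named fact.

Source followed — M. Artebani, I. Dolgachev, *The Hesse pencil of plane cubic curves*, L'Enseignement Math. (2) 55
(2009) 235–273, §5, Prop. 5.2 and its proof [arXiv:math/0611590, held `paper:arxiv-math_0611590` p0010 L51–L55,
p0011 L1–L2], VERBATIM:

> The union of the eight cubics `Bᵢ` cuts out on each nonsingular member of the Hesse pencil the set of points of
> order 9 in the group law with the point `p₀` as the origin. […] *Proof.* Recall that the sections `E₁, …, E₈` […]
> are non-trivial 3-torsion sections […]. The preimage `B̄ᵢ` of `Eᵢ` under the map `r⁻¹ ∘ σ` [`r = [3]` fibrewise]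
> cuts out on each nonsingular fibre the `Γ`-orbit of a point of order 9. Thus the image `Bᵢ` of `B̄ᵢ` in `ℙ²` is a
> plane cubic cutting out the `Γ`-orbit of a point of order 9 on each nonsingular member of the Hesse pencil. […]
> `2p ⊕ q = 2q ⊕ r = 2r ⊕ s = 0`. This immediately implies that `9p = 0` if and only if `p = s`.

and J. H. Silverman, *The Arithmetic of Elliptic Curves*, 2nd ed., GTM 106 (2009), Cor. III.6.4 (b):
`E[m] ≅ ℤ/mℤ × ℤ/mℤ` for `m` prime to the characteristic (here only through the tree's count `#E[m] = m²`).

## Dictionary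

* The preimage of the `3`-torsion section `Eᵢ ≠ E₀` under `r = [3]` is, in the group `A = E(K)`, the FIBRE
  `{P | 3•P = T}` of multiplication by `3` over a point `T ≠ O` with `3T = O`; in general `{P | n•P = Q}`.
* "`Γ`-orbit": `Γ ≅ (ℤ/3ℤ)²` acts by translations by the `3`-torsion points (the seat's `HessePencilGroupLaw`), so a
  `Γ`-orbit is a coset `P₀ + A[3]`; in general `P₀ + A[n]` (`AddSubgroup.torsionBy A n`).
* "points of order `9`": `addOrderOf P = 9 = 3²`; in general `p ^ (k + 1)`.

## What is here

* §1 (any additive commutative group `A`) `setOf_nsmul_eq_eq_image` (a non-empty fibre `{P | n•P = Q}` is the coset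
  `P₀ + A[n]` of any of its points), `nsmul_add_eq_of_mem_torsionBy` (fibres are stable under translation by `A[n]` — the
  `Γ`-invariance), `ncard_setOf_nsmul_eq` (`= #A[n]`); for a prime `p` (with the private helpers
  `ord P = p^{k+1} ↔ p^{k+1}P = 0 ∧ p^kP ≠ 0` and `A[p^k] ≤ A[p^{k+1}]`):
  **`setOf_addOrderOf_eq_prime_pow_succ`** (`{ord = p^{k+1}} = A[p^{k+1}] ∖ A[p^k]`),
  `addOrderOf_eq_prime_sq_of_nsmul_eq` (`pP = T`, `T ≠ 0`, `pT = 0` ⇒ `ord P = p²` — A–D's "any point in `B₁ ∩ E` is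
  a point of order 9"), **`setOf_addOrderOf_eq_prime_sq`** (`{ord = p²} = ⋃_{T ∈ A[p] ∖ 0} {P | pP = T}` — "the union
  … cuts out the set of points of order `p²`", as an identity of sets in any abelian group).
* §2 (`E` elliptic over an algebraically closed field `L`, `n ≠ 0` resp. `p ≠ 0` in `L`) `setOf_nsmul_eq_nonempty` and
  **`ncard_setOf_nsmul_eq_point`** (every fibre of `[n]` on `E(L)` is non-empty and has exactly `n²` points — each
  `Γ`-orbit cut out by a `Bᵢ` has `9` points), `ncard_torsionBy_sdiff_zero` (`#(E[p] ∖ 0) = p² − 1` — eight cubics),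
  **`ncard_setOf_addOrderOf_eq_prime_pow_succ`** (`#{P ∈ E(L) | ord P = p^{k+1}} = p^{2(k+1)} − p^{2k}`) and the
  printed case **`ncard_setOf_addOrderOf_eq_nine`** (`3 ≠ 0`: exactly `72 = 81 − 9 = 8·9` points of order `9`).

NOT here: the structure `E[m] ≅ (ℤ/mℤ)²` itself (the tree's `HesseConfiguration.nonempty_torsionBy_three_addEquiv`
for `m = 3`; `Motives/AbelianVarietyTorsionStructure` in the model layer), the Hesse dictionary (FILE 2).

## References
* [ArtebaniDolgachev2009] M. Artebani, I. Dolgachev, *The Hesse pencil of plane cubic curves*, Enseign. Math. (2)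
  55 (2009) 235–273, §5, Prop. 5.2 and its proof.
* [SilvermanAEC2009] J. H. Silverman, *The Arithmetic of Elliptic Curves*, 2nd ed., GTM 106, Springer 2009,
  Cor. III.6.4 (b), Prop. III.4.2 (a).

## Design
`open scoped Classical` as in `TorsionCardinality` / `PointDivisibilityProofs` (Mathlib's group law on
`WeierstrassCurve.Affine.Point` uses a `DecidableEq` instance; the tree's counts are stated classically).  The torsion
subgroups are Mathlib's `AddSubgroup.torsionBy A (n : ℤ)` with `n : ℕ` cast, exactly as in `card_torsionBy_eq_sq`.
-/

namespace Literature.NumberTheory.EllipticCurves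

open scoped Classical

universe u

section Group

variable {A : Type*} [AddCommGroup A]

/-! ## §1 Fibres of multiplication by `n` and points of prime-power order in an abelian group -/

/-- **A fibre of `[n]` is a coset of `A[n]`**: if `n•P₀ = Q` then `{P | n•P = Q} = P₀ + A[n]` ("the `Γ`-orbit of a
point" — `Γ` acting by translations by the `n`-torsion). [cite: ArtebaniDolgachev2009, §5 (proof of Prop. 5.2:
"`B̄ᵢ` … cuts out on each nonsingular fibre the `Γ`-orbit of a point of order 9")] -/
theorem setOf_nsmul_eq_eq_image {n : ℕ} {P₀ Q : A} (h₀ : n • P₀ = Q) :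
    {P : A | n • P = Q} = (fun T => P₀ + T) '' (AddSubgroup.torsionBy A n : Set A) := by
  ext P
  simp only [Set.mem_setOf_eq, Set.mem_image, SetLike.mem_coe]
  constructor
  · intro hP
    refine ⟨P - P₀, ?_, add_sub_cancel P₀ P⟩
    rw [AddSubgroup.torsionBy.nsmul_iff, smul_sub, hP, h₀, sub_self]
  · rintro ⟨T, hT, rfl⟩
    rw [AddSubgroup.torsionBy.nsmul_iff] at hT
    rw [smul_add, h₀, hT, add_zero]

/-- **Fibres of `[n]` are stable under translation by `A[n]`** (the `Γ`-invariance of each `Bᵢ ∩ E`): `n•P = Q` and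
`R ∈ A[n]` give `n•(P + R) = Q`. [cite: ArtebaniDolgachev2009, §5 (proof of Prop. 5.2: the `Γ`-orbit)] -/
theorem nsmul_add_eq_of_mem_torsionBy {n : ℕ} {P Q R : A} (hP : n • P = Q)
    (hR : R ∈ AddSubgroup.torsionBy A n) : n • (P + R) = Q := by
  rw [AddSubgroup.torsionBy.nsmul_iff] at hR
  rw [smul_add, hP, hR, add_zero]

/-- **A non-empty fibre of `[n]` has `#A[n]` elements.** [cite: ArtebaniDolgachev2009, §5 (proof of Prop. 5.2)] -/
theorem ncard_setOf_nsmul_eq {n : ℕ} {P₀ Q : A} (h₀ : n • P₀ = Q) :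
    {P : A | n • P = Q}.ncard = Nat.card (AddSubgroup.torsionBy A n) := by
  rw [setOf_nsmul_eq_eq_image h₀, Set.ncard_image_of_injective _ (add_right_injective P₀),
    ← Nat.card_coe_set_eq, SetLike.coe_sort_coe]

/-- `A[p^k] ≤ A[p^{k+1}]` (any natural `p`). [folklore] -/
private theorem torsionBy_pow_le (A : Type*) [AddCommGroup A] (p k : ℕ) :
    AddSubgroup.torsionBy A ((p ^ k : ℕ) : ℤ) ≤ AddSubgroup.torsionBy A ((p ^ (k + 1) : ℕ) : ℤ) := by
  intro P hP
  rw [AddSubgroup.torsionBy.nsmul_iff] at hP ⊢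
  rw [pow_succ', mul_smul, hP, smul_zero]

variable {p : ℕ} [hp : Fact p.Prime]

/-- Order exactly `p^{k+1}`: `addOrderOf P = p^{k+1}` iff `p^{k+1}•P = 0` and `p^k•P ≠ 0` (`p` prime;
Mathlib's `addOrderOf_eq_prime_pow` and `addOrderOf_dvd_of_nsmul_eq_zero`). [folklore] -/
private theorem addOrderOf_eq_prime_pow_succ_iff (P : A) (k : ℕ) :
    addOrderOf P = p ^ (k + 1) ↔ p ^ (k + 1) • P = 0 ∧ p ^ k • P ≠ 0 := by
  constructor
  · intro h
    refine ⟨by rw [← h]; exact addOrderOf_nsmul_eq_zero P, fun h' => ?_⟩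
    have hd := addOrderOf_dvd_of_nsmul_eq_zero h'
    rw [h, Nat.pow_dvd_pow_iff_le_right hp.out.one_lt] at hd
    omega
  · rintro ⟨h1, h2⟩
    exact addOrderOf_eq_prime_pow h2 h1

/-- **The points of order `p^{k+1}` are `A[p^{k+1}] ∖ A[p^k]`** (as subsets of `A`, `p` prime).
[cite: ArtebaniDolgachev2009, §5 (Prop. 5.2: "the set of points of order 9")] -/
theorem setOf_addOrderOf_eq_prime_pow_succ (k : ℕ) :
    {P : A | addOrderOf P = p ^ (k + 1)} =
      (AddSubgroup.torsionBy A ((p ^ (k + 1) : ℕ) : ℤ) : Set A) \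
        (AddSubgroup.torsionBy A ((p ^ k : ℕ) : ℤ) : Set A) := by
  ext P
  rw [Set.mem_setOf_eq, addOrderOf_eq_prime_pow_succ_iff, Set.mem_sdiff, SetLike.mem_coe, SetLike.mem_coe,
    AddSubgroup.torsionBy.nsmul_iff, AddSubgroup.torsionBy.nsmul_iff]

/-- **"any point in `B₁ ∩ E` is a point of order 9"**, in a general abelian group: if `p•P = T` with `T ≠ 0` and
`p•T = 0` (`p` prime), then `P` has order exactly `p²` (`p²P = pT = 0`, `pP = T ≠ 0`; the seat's
`addOrderOf_eq_nine_of_three_nsmul_add` is `p = 3` with `T ↦ −T`). [cite: ArtebaniDolgachev2009, §5 (proof of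
Prop. 5.2: "Hence we see that any point in `B₁ ∩ E` is a point of order 9")] -/
theorem addOrderOf_eq_prime_sq_of_nsmul_eq {P T : A} (h : p • P = T) (hT0 : T ≠ 0) (hT : p • T = 0) :
    addOrderOf P = p ^ 2 := by
  rw [show (2 : ℕ) = 1 + 1 from rfl, addOrderOf_eq_prime_pow_succ_iff]
  refine ⟨?_, ?_⟩
  · rw [pow_succ, pow_one, mul_smul, h, hT]
  · rw [pow_one, h]; exact hT0

/-- **"The union … cuts out … the set of points of order `9`"**, in a general abelian group and for a general
prime `p`: the points of order `p²` are the (disjoint) union over the non-zero `p`-torsion points `T` of the fibres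
`{P | p•P = T}`. [cite: ArtebaniDolgachev2009, §5 (Prop. 5.2: "The union of the eight cubics `Bᵢ` cuts out on each
nonsingular member of the Hesse pencil the set of points of order 9")] -/
theorem setOf_addOrderOf_eq_prime_sq :
    {P : A | addOrderOf P = p ^ 2} =
      ⋃ T ∈ (AddSubgroup.torsionBy A (p : ℤ) : Set A) \ {0}, {P : A | p • P = T} := by
  ext P
  simp only [Set.mem_setOf_eq, Set.mem_iUnion, Set.mem_sdiff, SetLike.mem_coe, Set.mem_singleton_iff,
    exists_prop]
  constructor
  · intro h
    rw [show (2 : ℕ) = 1 + 1 from rfl, addOrderOf_eq_prime_pow_succ_iff, pow_one] at h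
    refine ⟨p • P, ⟨?_, h.2⟩, rfl⟩
    rw [AddSubgroup.torsionBy.nsmul_iff, ← mul_smul, ← pow_two]
    exact h.1
  · rintro ⟨T, ⟨hT, hT0⟩, hPT⟩
    rw [AddSubgroup.torsionBy.nsmul_iff] at hT
    exact addOrderOf_eq_prime_sq_of_nsmul_eq hPT hT0 hT

end Group

section Curve

variable {L : Type u} [Field L] [IsAlgClosed L] (E : WeierstrassCurve L) [E.IsElliptic]

/-! ## §2 On `E(L)`, `L` algebraically closed: every fibre of `[n]` has `n²` points; `p²(p² − 1)` points of order `p²` -/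

/-- **Every fibre of `[n]` on `E(L)` is non-empty** (`L` algebraically closed, `E` elliptic, `n ≠ 0` in `L`): the
tree's `nsmul_surjective_of_isAlgClosed` (Silverman AEC III.4.2 (a)). [cite: SilvermanAEC2009, Prop. III.4.2 (a)] -/
theorem setOf_nsmul_eq_nonempty {n : ℕ} (hn : (n : L) ≠ 0) (Q : E.toAffine.Point) :
    {P : E.toAffine.Point | n • P = Q}.Nonempty := by
  have hn0 : n ≠ 0 := by rintro rfl; exact hn Nat.cast_zero
  obtain ⟨P₀, hP₀⟩ := E.nsmul_surjective_of_isAlgClosed hn0 Q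
  exact ⟨P₀, hP₀⟩

/-- **Every fibre of `[n]` on `E(L)` has exactly `n²` points** (`L` algebraically closed, `E` elliptic, `n ≠ 0` in
`L`): it is a coset of `E[n]` (`setOf_nsmul_eq_eq_image`) and `#E[n] = n²` (`card_torsionBy_eq_sq`) — so each of
A–D's `Γ`-orbits `Bᵢ ∩ E` (fibres of `[3]` over the eight non-zero `3`-torsion points) has `9` points.
[cite: ArtebaniDolgachev2009, §5 (proof of Prop. 5.2: "the `Γ`-orbit of a point of order 9")]
[cite: SilvermanAEC2009, Cor. III.6.4 (b)] -/
theorem ncard_setOf_nsmul_eq_point {n : ℕ} (hn : (n : L) ≠ 0) (Q : E.toAffine.Point) :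
    {P : E.toAffine.Point | n • P = Q}.ncard = n ^ 2 := by
  obtain ⟨P₀, hP₀⟩ := setOf_nsmul_eq_nonempty E hn Q
  rw [ncard_setOf_nsmul_eq hP₀, E.card_torsionBy_eq_sq hn]

variable {p : ℕ} [hp : Fact p.Prime]

omit hp in
/-- **`#(E[p] ∖ 0) = p² − 1`** (`p ≠ 0` in `L`, any natural `p`): for `p = 3` the EIGHT non-zero `3`-torsion points — the eight
sections `E₁, …, E₈`, the eight cubics `B₁, …, B₈`. [cite: ArtebaniDolgachev2009, §5 (proof of Prop. 5.2: "the
sections `E₁, …, E₈` … are non-trivial 3-torsion sections")] [cite: SilvermanAEC2009, Cor. III.6.4 (b)] -/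
theorem ncard_torsionBy_sdiff_zero (hpL : (p : L) ≠ 0) :
    ((AddSubgroup.torsionBy E.toAffine.Point (p : ℤ) : Set E.toAffine.Point) \ {0}).ncard = p ^ 2 - 1 := by
  have c := E.card_torsionBy_eq_sq hpL
  rw [Set.ncard_sdiff_singleton_of_mem (AddSubgroup.zero_mem _), ← Nat.card_coe_set_eq,
    SetLike.coe_sort_coe, c]

/-- **`#{P ∈ E(L) | ord P = p^{k+1}} = p^{2(k+1)} − p^{2k}`** for an elliptic curve over an algebraically closed
field with `p ≠ 0` in `L` (`= #E[p^{k+1}] − #E[p^k]`, both from `card_torsionBy_eq_sq`).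
[cite: SilvermanAEC2009, Cor. III.6.4 (b)] [cite: ArtebaniDolgachev2009, §5 (Prop. 5.2: "the set of points of order 9")] -/
theorem ncard_setOf_addOrderOf_eq_prime_pow_succ (hpL : (p : L) ≠ 0) (k : ℕ) :
    {P : E.toAffine.Point | addOrderOf P = p ^ (k + 1)}.ncard = p ^ (2 * (k + 1)) - p ^ (2 * k) := by
  have hk : ((p ^ k : ℕ) : L) ≠ 0 := by rw [Nat.cast_pow]; exact pow_ne_zero _ hpL
  have hk1 : ((p ^ (k + 1) : ℕ) : L) ≠ 0 := by rw [Nat.cast_pow]; exact pow_ne_zero _ hpL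
  have c0 := E.card_torsionBy_eq_sq hk
  have c1 := E.card_torsionBy_eq_sq hk1
  haveI : Finite (AddSubgroup.torsionBy E.toAffine.Point ((p ^ k : ℕ) : ℤ)) :=
    Nat.finite_of_card_ne_zero (by rw [c0]; exact pow_ne_zero 2 (pow_ne_zero k hp.out.ne_zero))
  rw [setOf_addOrderOf_eq_prime_pow_succ,
    Set.ncard_sdiff (SetLike.coe_subset_coe.2 (torsionBy_pow_le E.toAffine.Point p k)) (Set.toFinite _),
    ← Nat.card_coe_set_eq, SetLike.coe_sort_coe, c1, ← Nat.card_coe_set_eq, SetLike.coe_sort_coe, c0,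
    ← pow_mul, ← pow_mul, Nat.mul_comm (k + 1) 2, Nat.mul_comm k 2]

/-- **Artebani–Dolgachev's points of order `9`, counted**: on an elliptic curve over an algebraically closed field
with `3 ≠ 0` there are exactly `72 = 81 − 9 = 8 · 9` points of order `9` — eight `Γ`-orbits (cosets of `E[3]`,
`#E[3] = 9`), one on each cubic `Bᵢ` (FILE 2). [cite: ArtebaniDolgachev2009, §5 (Prop. 5.2: "The union of the eight
cubics `Bᵢ` cuts out … the set of points of order 9")] -/
theorem ncard_setOf_addOrderOf_eq_nine (h3 : (3 : L) ≠ 0) :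
    {P : E.toAffine.Point | addOrderOf P = 9}.ncard = 72 := by
  haveI : Fact (Nat.Prime 3) := ⟨Nat.prime_three⟩
  have h := ncard_setOf_addOrderOf_eq_prime_pow_succ E (p := 3) (by exact_mod_cast h3) 1
  norm_num at h
  exact h

end Curve

end Literature.NumberTheory.EllipticCurves
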